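import Literature.NumberTheory.GaloisRepresentations.ContinuousShapiroLiftMackeyCup
import HarnessLib

/-!
# Sketch (stub-ideation `sidea-stub_cmLambdaLower-3`, k = 3, gen 11) — the **S₀-MACKEY PACKAGE**: the S₀-dictionary of the
# «ONE `SelmerComplement` call per (n,k)» (critic S56/S53/V42) in the K = ℚ Shapiro model, as a DECOMPOSITION of the levelwise
# existence step `hne` of item 7 `stub_deepHalfAwayTwo` (S4₀) into sub-stubs R1–R4 with a PROVED glue — and R1, R2 PROVED generically

Crux `ResidualThetaCountLowerPureAtTwo` (stmt-26074, OPEN) ▸ skeleton `Lines/bt26_lambda.lean` v6 ▸ stub `stub_cmLambdaLower` =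
BY NAME the route item `ResidualSignedLambdaLowerCMAtTwo` (RSL_g, stmt-22608, OPEN). Nothing here proves RSL_g, the crux, or BSD;
the stub statement is never re-typed. This file is kernel-checked scaffolding for ONE interior step of the lead's v2/v2a skeleton:
the diagonal non-emptiness `hne` of the finite solution sets `Sol(n,k)` of S4₀ (critic STUB-PLAN rev 14, S56 step (3): «row 2
levelwise = ONE `SelmerComplement` call per (n,k), EXACT»; the Kőnig step that consumes `hne` is k3-g10's and is NOT repeated).

POSITION W.R.T. THE TREE.  TP2's landed `…PTDeep{SelmerSocket,CoindShapiro,LocalTransport,AdmissibleTransport}.lean` (08-28) run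
`SelmerComplement` on `Maps(Γ_ℚ ⧸ Γ_n, A[2^k])` over K = ℚ with a ONE-PLACE LIFT at the place over 2 (ONE orbit: 2 is totally
ramified in ℚ_n) and all-orbit VANISHING transports at the other places of S.  Item 7 of THIS crux needs, at every ℓ ∈ S₀ (odd,
`2^{min(n,n_ℓ)}` orbits = primes of ℚ_n over ℓ), PRESCRIBED NON-ZERO components along every orbit (the target χ ∈ P_{S₀}) for an
ARBITRARY local datum — this is exactly (R1) H¹-level Mackey surjectivity and (R2) the orbit splitting of the local cup term with an
arbitrary second factor, neither of which is in the tree (the landed (M) file `ContinuousShapiroLiftMackeyCup` has the projections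
`Φ_c` and the cup formula for two GLOBAL Shapiro lifts only).  Both are PROVED below in the generic continuous-cohomology currency.

* §A  ABSTRACT GLUE (proved, 0 sorry): from (R1) joint surjectivity of the orbit projections on the produced side, (R2) the orbit
  splitting of the local term, the `⟹` dictionaries (R3/R4) `Sh a ∈ Sel_{𝓖'} → good a`, `ShD x ∈ Sel_{𝓕'*} → goodT x`, and ONE
  abstract call of `SelmerComplement` (ii) (with `IsPerfect` and `u₂ = u_∞ = 0` folded in), the levelwise existence with
  prescribed orbit components follows. One-orbit unit test included.
* §B  GENERIC ENGINES over the tree's API (`coindFin`, `resCoindFinHomR` = Φ_c of the landed (M) file, `shapiroLift`, `conjMap`):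
  (B1) Mackey AT MODULE LEVEL — `(Φ_{g_i N})_i` is JOINTLY BIJECTIVE (proved); (B2) ORBIT DETECTION — `θ^*(Sh a) = 0 ⟹ θ_N^*(g·a) = 0`
  for every `g` (proved; generic twin of TP2's `resOfLe_decomp_conjH1_eq_zero_of_localization_shapiroLift_eq_zero`; the `⟹` core of
  R3/R4); (B3) the typed statements `LocalMackeyH1Surjective` (R1) and `LocalCupSplitsAlongOrbits` (R2); (B4) R2 PROVED from (M)
  §1/§3/§4 + Mathlib `ContinuousCohomology.map_id`; (B5) R1 PROVED by an explicit inverse on cocycles `Z(d)(ē(y')·g_iN) := F_i(d)(y')`.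
-/

namespace Summit.BirchSwinnertonDyer.BirchSwinnertonDyer.Cruxes.ResidualThetaCountLowerPureAtTwo.SideaK3G11

/-! ## §A The abstract glue: levelwise existence with prescribed orbit components from the Mackey package -/

section Glue

open scoped BigOperators

variable {Λ : Type*} [Fintype Λ]
variable {ι : Λ → Type*} [∀ l, Fintype (ι l)]
variable {Hn HT HG HGd Q : Type*} [AddCommMonoid Q]
variable {C Cd Lg Ld : Λ → Type*}

/-- **Levelwise existence from the S₀-Mackey package.**  Dictionary (level `n`, modulus `2^k`, `Λ = S₀`, `ι ℓ` = the
`Γ_{ℚ_ℓ}`-orbits on `Γ_ℚ ⧸ Γ_n`, i.e. the primes of `ℚ_n` above `ℓ`):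
* `Sh : Hn → HG` = global Shapiro lift `H¹(Γ_n, A[2^k]) → H¹(Γ_ℚ, Maps(Γ_ℚ⧸Γ_n, A[2^k]))` (onto: `shapiroLift_surjective`);
* `ShD : HT → HGd` = `H¹(Ψ) ∘ Sh` on the `T`-side, onto `H¹(ℚ, Maps(…)^D)` (`exists_unique_shapiroLift_coindTateDualMor_eq`);
* `locG ℓ`, `locD ℓ` = `galoisCohomology.localization … (Sum.inr ℓ) 1` on the two sides;
* `comp ℓ i a` = `Sh^{D}_{N_D}⁻¹ ∘ H¹(θ_ℓ, Φ_{g_i}) (Sh a)` = `θ_N^*(g_i · a)` (landed `map_resCoindFinHomR_shapiroLift`), `compT` likewise;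
* `πd ℓ i` = `Sh^{D}⁻¹ ∘ H¹(Φ_{g_i}) ∘ H¹(Ψ_θ)⁻¹` on LOCAL dual classes, `hπd` its compatibility with `ShD` (R2/T-side, landed pieces);
* `P ℓ` = local Tate pairing of `Maps(Γ⧸Γ_n, A[2^k])` at `ℓ` (values in `Q = ZMod 2^k` after `inv_ℓ`), `p ℓ` = the layer pairing
  at `ℓ` in the fixed frame (same representative `g_i` on both factors, critic U43), `hsplit` = (R2);
* `hR1` = (R1);  `hdict` = (R3 ⟹, R4 ⟹) for `𝓖' = (0 at 2, ⊤ at S₀ ∪ {∞}, unramified elsewhere)`;  `hdictT` = (R3) on the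
  `T`-side for `𝓕'* = (everything at 2·S₀·∞, unramified elsewhere)` (`UnramifiedOrthogonal.isUnramifiedOutside_dualSelmerStructure`);
* `hSC` = `SelmerComplement` clause (ii) for `𝓕' ≤ 𝓖'` applied to the local family `(0 at 2, u_ℓ at S₀, 0 at ∞)`, with
  `IsPerfect` turning `loc_ℓ y − u_ℓ ∈ 𝓖'*_ℓ = ⊤^⊥ = ⊥` into equality;
* `hyp` = the hypothesis of `LevelwiseDeepHalfAwayTwo n k` (orthogonality to all good level-`n` test classes);
* conclusion = its conclusion: a `T`-class at level `n`, good (unramified outside `2·S₀·∞`), with the prescribed components. -/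
theorem levelwise_exists_of_mackeyPackage
    (Sh : Hn → HG) (hSh : Function.Surjective Sh)
    (ShD : HT → HGd) (hShD : Function.Surjective ShD)
    (locG : ∀ l, HG → Lg l) (locD : ∀ l, HGd → Ld l)
    (comp : ∀ l, ι l → Hn → C l) (compT : ∀ l, ι l → HT → Cd l)
    (πd : ∀ l, ι l → Ld l → Cd l) (hπd : ∀ l i x, πd l i (locD l (ShD x)) = compT l i x)
    (P : ∀ l, Lg l → Ld l → Q) (p : ∀ l, C l → Cd l → Q)
    (hsplit : ∀ l a u, P l (locG l (Sh a)) u = ∑ i, p l (comp l i a) (πd l i u))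
    (hR1 : ∀ l (t : ι l → Cd l), ∃ u : Ld l, ∀ i, πd l i u = t i)
    (good : Hn → Prop) (SelG : HG → Prop) (hdict : ∀ a, SelG (Sh a) → good a)
    (goodT : HT → Prop) (SelFd : HGd → Prop) (hdictT : ∀ x, SelFd (ShD x) → goodT x)
    (hSC : ∀ u : (∀ l, Ld l), (∀ x', SelG x' → ∑ l, P l (locG l x') (u l) = 0) →
      ∃ y, SelFd y ∧ ∀ l, locD l y = u l)
    (t : ∀ l, ι l → Cd l) (hyp : ∀ a, good a → ∑ l, ∑ i, p l (comp l i a) (t l i) = 0) :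
    ∃ x : HT, goodT x ∧ ∀ l i, compT l i x = t l i := by
  classical
  choose u hu using fun l => hR1 l (t l)
  obtain ⟨y, hyF, hyloc⟩ := hSC u (fun x' hx' => by
    obtain ⟨a, rfl⟩ := hSh x'
    have ha : good a := hdict a hx'
    calc ∑ l, P l (locG l (Sh a)) (u l) = ∑ l, ∑ i, p l (comp l i a) (πd l i (u l)) :=
          Finset.sum_congr rfl (fun l _ => hsplit l a (u l))
      _ = ∑ l, ∑ i, p l (comp l i a) (t l i) :=
          Finset.sum_congr rfl (fun l _ => Finset.sum_congr rfl (fun i _ => by rw [hu]))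
      _ = 0 := hyp a ha)
  obtain ⟨x, rfl⟩ := hShD y
  exact ⟨x, hdictT x hyF, fun l i => by rw [← hπd l i x, hyloc l, hu]⟩

/-- **Unit test (one orbit everywhere, e.g. level `n = 0`): the package collapses to a plain `SelmerComplement` (ii) call.**
With `ι ℓ = Unit`, `Hn = HG`, `Sh = id`, components = localisations and `p = P`, the splitting hypothesis is `Fintype.sum_unique`
and R1 is trivial; the theorem returns exactly clause (ii) (in the `IsPerfect`-sharpened form) read back on `HT`. -/
example (ShD : HT → HGd) (hShD : Function.Surjective ShD)
    (locG : ∀ l, HG → Lg l) (locD : ∀ l, HGd → Ld l) (P : ∀ l, Lg l → Ld l → Q)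
    (SelG : HG → Prop) (goodT : HT → Prop) (SelFd : HGd → Prop) (hdictT : ∀ x, SelFd (ShD x) → goodT x)
    (hSC : ∀ u : (∀ l, Ld l), (∀ x', SelG x' → ∑ l, P l (locG l x') (u l) = 0) →
      ∃ y, SelFd y ∧ ∀ l, locD l y = u l)
    (t : ∀ l : Λ, Unit → Ld l) (hyp : ∀ a, SelG a → ∑ l, ∑ i, P l (locG l a) (t l i) = 0) :
    ∃ x : HT, goodT x ∧ ∀ l i, locD l (ShD x) = t l i :=
  levelwise_exists_of_mackeyPackage (ι := fun _ => Unit) id Function.surjective_id ShD hShD locG locD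
    (fun l _ => locG l) (fun l _ x => locD l (ShD x)) (fun _ _ => id) (fun _ _ _ => rfl) P P
    (fun l a u => by simp) (fun l t => ⟨t (), fun i => rfl⟩) SelG SelG (fun _ h => h) goodT SelFd hdictT hSC t hyp

end Glue

/-! ## §B Generic engines over the tree's continuous cohomology (no number theory) -/

noncomputable section

open CategoryTheory
open Literature.NumberTheory.GaloisRepresentations

universe u v w

variable {R : Type u} [CommRing R] [TopologicalSpace R]
variable {G : Type v} [Group G] [TopologicalSpace G]
variable {D : Type v} [Group D] [TopologicalSpace D]

/-- **(B1) Mackey's decomposition at module level — PROVED.** If `g : ι → G` are orbit representatives of the `D`-action on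
`G ⧸ N` through `θ` (`(i, y') ↦ ē(y')·g_i N` bijective), then `F ↦ (Φ_{g_i N} F)_i` is a BIJECTION
`Maps(G ⧸ N, X) → Π_i Maps(D ⧸ θ⁻¹N, X)`; each `Φ_{g_i N}` being a morphism of `D`-representations (`resCoindFinHomR`), this is the
isomorphism `θ^* Ind_N^G X ≅ ⊕_{θ(D)gN} Ind_{θ⁻¹N}^D θ^*X` whose PROJECTIONS the landed (M) file built.
[Brown1982 III (5.6)(b); NSW (1.5.6)–(1.5.7)] -/
theorem resCoindFinHomR_jointly_bijective (X : TopRep.{v} R G) (N : Subgroup G) [N.Normal] (θ : D →ₜ* G)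
    {ι : Type w} (g : ι → G)
    (hbij : Function.Bijective fun q : ι × (D ⧸ N.comap (θ : D →* G)) => quotientMapOfHom N θ q.2 * (g q.1 : G ⧸ N)) :
    Function.Bijective fun F : coindFin X N => fun i => (resCoindFinHomR X N θ (g i : G ⧸ N)).hom F := by
  classical
  set e : ι × (D ⧸ N.comap (θ : D →* G)) ≃ G ⧸ N := Equiv.ofBijective _ hbij with he
  refine ⟨fun F₁ F₂ h => ?_, fun t => ?_⟩
  · funext y
    obtain ⟨⟨i, y'⟩, rfl⟩ := e.surjective y
    exact congrFun (congrFun h i) y'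
  · refine ⟨fun y => t (e.symm y).1 (e.symm y).2, funext fun i => funext fun y' => ?_⟩
    have hsymm : e.symm (quotientMapOfHom N θ y' * (g i : G ⧸ N)) = (i, y') := by
      rw [Equiv.symm_apply_eq]; rfl
    change (fun y => t (e.symm y).1 (e.symm y).2) (quotientMapOfHom N θ y' * (g i : G ⧸ N)) = t i y'
    dsimp only
    rw [hsymm]

variable [IsTopologicalGroup G] [IsTopologicalGroup D]

/-- **(B2) Orbit detection — PROVED.** If the restriction `θ^*(Sh_N^G a) ∈ H¹(D, Maps(G ⧸ N, X)|_θ)` of a Shapiro lift vanishes,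
then for EVERY `γ ∈ G` the class `θ_N^*(γ · a) ∈ H¹(θ⁻¹N, X|_θ)` vanishes (apply `H¹(Φ_{γN})`, the landed
`map_resCoindFinHomR_shapiroLift`, and local Shapiro injectivity).  With `D = Γ_{ℚ_2}` (one orbit) this is the `⟹` half of
R4 (`loc₂(Sh a) = 0 ⟹ layerLoc₂ a = 0`); with `D = I_q` an inertia group (`q ∤ 2·S₀`, so `θ(D) ≤ Γ_n = N`, `θ⁻¹N = D`) it is the
`⟹` half of R3 (`loc_q(Sh a)` unramified ⟹ every conjugate of `a` dies on `I_q`). [NSW (1.6.4)–(1.6.5)] -/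
theorem forall_conj_eq_zero_of_map_shapiroLift_eq_zero (X : TopRep.{v} R G) (N : Subgroup G) [N.Normal] (θ : D →ₜ* G)
    (hN : IsOpen (N : Set G)) {s : G ⧸ N → G} (hs : ∀ y : G ⧸ N, (s y : G ⧸ N) = y) (hs1 : s ((1 : G) : G ⧸ N) = 1)
    {sD : D ⧸ N.comap (θ : D →* G) → D} (hsD : ∀ y, (sD y : D ⧸ N.comap (θ : D →* G)) = y)
    (hsD1 : sD ((1 : D) : D ⧸ N.comap (θ : D →* G)) = 1) (a : continuousCohomology 1 (subgroupRep X N))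
    (h0 : ContinuousCohomology.map θ (𝟙 (TopRep.res (θ : D →* G) (coindFin X N))) 1 (shapiroLift X N hN hs hs1 a) = 0)
    (γ : G) :
    ContinuousCohomology.map (comapSubtypeHom N θ) (comapCoeffHom X N θ) 1 (conjMap X N γ 1 a) = 0 := by
  apply shapiroLift_injective (TopRep.res (θ : D →* G) X) (N.comap (θ : D →* G)) (isOpen_comap N θ hN) hsD hsD1
  rw [map_zero, ← map_resCoindFinHomR_shapiroLift X N θ hN hs hs1 hsD hsD1 γ a]
  -- factor `H¹(θ, Φ_{γN}) = H¹(Φ_{γN}) ∘ θ^*` on cocycles, then use `θ^*(Sh a) = 0`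
  have hfac : ContinuousCohomology.map θ (resCoindFinHomR X N θ (γ : G ⧸ N)) 1 (shapiroLift X N hN hs hs1 a) =
      cohomologyMap (resCoindFinHomR X N θ (γ : G ⧸ N)) 1
        (ContinuousCohomology.map θ (𝟙 (TopRep.res (θ : D →* G) (coindFin X N))) 1 (shapiroLift X N hN hs hs1 a)) := by
    obtain ⟨F, hF⟩ := oneCocycleClass_surjective _ (shapiroLift X N hN hs hs1 a)
    rw [← hF, map_oneCocycleClass, map_oneCocycleClass, cohomologyMap_oneCocycleClass]
    rfl
  rw [hfac, h0, map_zero]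

/-- **(B3·R1) `LocalMackeyH1Surjective` — NEW helper lemma (typed here; PROVED below as (B5)/(B5′)).**  H¹-level Mackey surjectivity: every
tuple of layer classes `(b_i ∈ H¹(θ⁻¹N, X|_θ))_i`, one per orbit, is the tuple of orbit components `H¹(Φ_{g_i N}) z` of ONE class
`z ∈ H¹(D, Maps(G ⧸ N, X)|_θ)` (read back through the local Shapiro lifts).  Proof plan: (B1) is a `D`-equivariant continuous
linear bijection onto the product representation, so `H¹` of it is bijective (`continuousCohomologyEquivOfIso ∘ topRepIsoOfEquiv`,
pattern of `bijective_cohomologyMap_coindTateDualMor`); a product of cocycles is a cocycle; finish with `shapiroLift_surjective`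
orbitwise.  Size M.  [Brown1982 III (5.6)(b), (6.5); NSW (1.5.6), (1.6.4)] -/
def LocalMackeyH1Surjective (X : TopRep.{v} R G) (N : Subgroup G) [N.Normal] (θ : D →ₜ* G) (hN : IsOpen (N : Set G)) : Prop :=
  ∀ ⦃ι : Type w⦄ [Fintype ι] (g : ι → G),
    (Function.Bijective fun q : ι × (D ⧸ N.comap (θ : D →* G)) => quotientMapOfHom N θ q.2 * (g q.1 : G ⧸ N)) →
    ∀ ⦃sD : D ⧸ N.comap (θ : D →* G) → D⦄ (hsD : ∀ y, (sD y : D ⧸ N.comap (θ : D →* G)) = y)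
      (hsD1 : sD ((1 : D) : D ⧸ N.comap (θ : D →* G)) = 1)
      (b : ι → continuousCohomology 1 (subgroupRep (TopRep.res (θ : D →* G) X) (N.comap (θ : D →* G)))),
      ∃ z : continuousCohomology 1 (TopRep.res (θ : D →* G) (coindFin X N)),
        ∀ i, cohomologyMap (resCoindFinHomR X N θ (g i : G ⧸ N)) 1 z =
          shapiroLift (TopRep.res (θ : D →* G) X) (N.comap (θ : D →* G)) (isOpen_comap N θ hN) hsD hsD1 (b i)

/-- **(B3·R2) `LocalCupSplitsAlongOrbits` — NEW helper lemma (typed here; PROVED below as (B4)).**  The LOCAL cup product of the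
restriction of a Shapiro lift with an ARBITRARY local class `u ∈ H¹(D, Maps(G ⧸ N, Y)|_θ)` (not a restriction of a global class)
splits along the orbits: `θ^*(Sh a) ∪_{ΣP} u = Σ_i Sh^D(θ_N^*(g_i · a)) ∪_{ΣP|_θ} H¹(Φ_{g_i N}) u` in `H²(D, Z|_θ)`.  The landed
`map_cupProduct_coindFin_shapiroLift_sum` is the case `u = θ^*(Sh b)`; clause (ii) of `SelmerComplement` needs arbitrary `u`
(the local datum `u_ℓ`).  Proof plan: (M) §1 `cupProduct_mapPair_sum` with `θ := id_D`, `α_i = β_i := Φ_{g_i N}`, compatibility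
(M) §4 `coindFin_toLin_sum_resCoindFinHomR`, then (M) §3 on the first factor via the factorisation `H¹(θ, Φ) = H¹(Φ) ∘ θ^*`
(as in (B2)).  Size S–M.  The number-field form (local Tate pairing `localTatePairing (ρ.coind U hU) n v` through `Ψ_θ`) is the
many-orbit twin of the landed ONE-orbit `localTatePairing_coind_cohomologyMap_eq_cupProduct_pull`. [NSW (1.5.3)(iv), (1.6.5)] -/
def LocalCupSplitsAlongOrbits [LocallyCompactSpace G] [LocallyCompactSpace D] {X Y Z : TopRep.{v} R G} (P : ContPairing X Y Z)
    (N : Subgroup G) [N.Normal] (θ : D →ₜ* G) [Fintype (G ⧸ N)] [Fintype (D ⧸ N.comap (θ : D →* G))]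
    (hN : IsOpen (N : Set G)) : Prop :=
  ∀ ⦃ι : Type w⦄ [Fintype ι] (g : ι → G),
    (Function.Bijective fun q : ι × (D ⧸ N.comap (θ : D →* G)) => quotientMapOfHom N θ q.2 * (g q.1 : G ⧸ N)) →
    ∀ ⦃s : G ⧸ N → G⦄ (hs : ∀ y : G ⧸ N, (s y : G ⧸ N) = y) (hs1 : s ((1 : G) : G ⧸ N) = 1)
      ⦃sD : D ⧸ N.comap (θ : D →* G) → D⦄ (hsD : ∀ y, (sD y : D ⧸ N.comap (θ : D →* G)) = y)
      (hsD1 : sD ((1 : D) : D ⧸ N.comap (θ : D →* G)) = 1)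
      (a : continuousCohomology 1 (subgroupRep X N)) (u : continuousCohomology 1 (TopRep.res (θ : D →* G) (coindFin Y N))),
      ((P.coindFin N).restrict θ).cupProduct
          (ContinuousCohomology.map θ (𝟙 (TopRep.res (θ : D →* G) (coindFin X N))) 1 (shapiroLift X N hN hs hs1 a)) u =
        ∑ i, ((P.restrict θ).coindFin (N.comap (θ : D →* G))).cupProduct
          (shapiroLift (TopRep.res (θ : D →* G) X) (N.comap (θ : D →* G)) (isOpen_comap N θ hN) hsD hsD1
            (ContinuousCohomology.map (comapSubtypeHom N θ) (comapCoeffHom X N θ) 1 (conjMap X N (g i) 1 a)))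
          (cohomologyMap (resCoindFinHomR Y N θ (g i : G ⧸ N)) 1 u)

/-- **(B4) R2 in the generic setting — PROVED** from the landed (M) file: §1 (`cupProduct_mapPair_sum` with `θ := id_D` and
the family `Φ_{g_i N}` on both factors), §4 (compatibility of the summed pairings) and §3 (orbit components of a Shapiro lift),
plus `map_id_eq_id` and the cocycle-level factorisation `H¹(θ, Φ) = H¹(Φ) ∘ θ^*`.  What remains for the number-field R2 is
the dialect bridge `localTatePairing (ρ.coind U hU) n v _ (H¹(Ψ_θ) z) = inv? ∘ cup for the summed pairing` — verbatim the
first four lines of the landed one-orbit proof `localTatePairing_coind_cohomologyMap_eq_cupProduct_pull`. -/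
theorem localCupSplitsAlongOrbits [LocallyCompactSpace G] [LocallyCompactSpace D] {X Y Z : TopRep.{v} R G}
    (P : ContPairing X Y Z) (N : Subgroup G) [N.Normal] (θ : D →ₜ* G) [Fintype (G ⧸ N)]
    [Fintype (D ⧸ N.comap (θ : D →* G))] (hN : IsOpen (N : Set G)) :
    LocalCupSplitsAlongOrbits.{u, v, w} P N θ hN := by
  intro ι _ g hbij s hs hs1 sD hsD hsD1 a u
  -- (1) split the `D`-level cup product along the family `Φ_{g_i N}` ((M) §1 with `θ := id_D`; compatibility = (M) §4)
  have h1 := ContPairing.cupProduct_mapPair_sum Finset.univ ((P.coindFin N).restrict θ)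
    ((P.restrict θ).coindFin (N.comap (θ : D →* G))) (ContinuousMonoidHom.id D)
    (fun i => resIdHom (resCoindFinHomR X N θ (g i : G ⧸ N))) (fun i => resIdHom (resCoindFinHomR Y N θ (g i : G ⧸ N)))
    (𝟙 (TopRep.res (θ : D →* G) Z))
    (fun F F' => by
      change (P.coindFin N).toLin F F' = _
      rw [ContPairing.coindFin_toLin_sum_resCoindFinHomR P N θ (fun i => (g i : G ⧸ N)) hbij F F']
      rfl)
    (ContinuousCohomology.map θ (𝟙 (TopRep.res (θ : D →* G) (coindFin X N))) 1 (shapiroLift X N hN hs hs1 a)) u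
  -- (2) the left-hand side is the cup product itself (Mathlib `ContinuousCohomology.map_id`)
  rw [ContinuousCohomology.map_id] at h1
  change ((P.coindFin N).restrict θ).cupProduct _ u = _ at h1
  -- (3) first factors: `H¹(Φ_{g_i N})(θ^* Sh a) = H¹(θ, Φ_{g_i N})(Sh a) = Sh^D(θ_N^*(g_i · a))` ((M) §3)
  have hfac : ∀ i, ContinuousCohomology.map (ContinuousMonoidHom.id D) (resIdHom (resCoindFinHomR X N θ (g i : G ⧸ N))) 1
      (ContinuousCohomology.map θ (𝟙 (TopRep.res (θ : D →* G) (coindFin X N))) 1 (shapiroLift X N hN hs hs1 a)) =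
      shapiroLift (TopRep.res (θ : D →* G) X) (N.comap (θ : D →* G)) (isOpen_comap N θ hN) hsD hsD1
        (ContinuousCohomology.map (comapSubtypeHom N θ) (comapCoeffHom X N θ) 1 (conjMap X N (g i) 1 a)) := fun i => by
    rw [← map_resCoindFinHomR_shapiroLift X N θ hN hs hs1 hsD hsD1 (g i) a]
    obtain ⟨F, hF⟩ := oneCocycleClass_surjective _ (shapiroLift X N hN hs hs1 a)
    rw [← hF, map_oneCocycleClass, map_oneCocycleClass, map_oneCocycleClass]
    rfl
  simpa only [hfac] using h1


omit [IsTopologicalGroup G] in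
/-- **(B5) R1 PROVED at class level: the family `(H¹(Φ_{g_i N}))_i` is JOINTLY SURJECTIVE**
`H¹(D, θ^* Maps(G ⧸ N, X)) ↠ Π_i H¹(D, Maps(D ⧸ θ⁻¹N, X|_θ))` whenever `(i, y') ↦ ē(y')·g_iN` is a bijection
`ι × D ⧸ θ⁻¹N ≃ G ⧸ N` (Mackey: the double cosets `θ(D) g_i N`).  Explicit inverse on cocycles: given cocycles `F_i` of the
targets, `Z(d)(ē(y')·g_iN) := F_i(d)(y')` is a continuous crossed homomorphism of `D` into `θ^* Maps(G ⧸ N, X)` with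
`Φ_{g_iN} ∘ Z = F_i` (the cocycle identity is checked fibrewise, using `ē(d⁻¹y')·g_iN = θ(d)⁻¹·(ē(y')·g_iN)`).
Combined with Shapiro for `(D, θ⁻¹N)` this is `H¹(D, θ^* Ind) ↠ ⊕_i H¹(θ⁻¹N, g_i^* X)` — the S₀-dictionary's existence half.
[cite: Brown1982, III §5 (5.6)(b)] [cite: NeukirchSchmidtWingberg2008, I §5 (1.5.6)–(1.5.7), I §6 (1.6.4)] -/
theorem exists_cohomologyMap_resCoindFinHomR_eq (X : TopRep.{v} R G) (N : Subgroup G) [N.Normal] (θ : D →ₜ* G)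
    {ι : Type w} (g : ι → G)
    (hbij : Function.Bijective fun q : ι × (D ⧸ N.comap (θ : D →* G)) => quotientMapOfHom N θ q.2 * (g q.1 : G ⧸ N))
    (c : ι → continuousCohomology 1 (coindFin (TopRep.res (θ : D →* G) X) (N.comap (θ : D →* G)))) :
    ∃ z : continuousCohomology 1 (TopRep.res (θ : D →* G) (coindFin X N)),
      ∀ i, cohomologyMap (resCoindFinHomR X N θ (g i : G ⧸ N)) 1 z = c i := by
  classical
  choose F hF using fun i => oneCocycleClass_surjective _ (c i)
  set e := Equiv.ofBijective _ hbij with he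
  have key : ∀ (i : ι) (y' : D ⧸ N.comap (θ : D →* G)) (d : D),
      e.symm ((θ d)⁻¹ • e (i, y')) = (i, d⁻¹ • y') := fun i y' d => by
    rw [Equiv.symm_apply_eq]
    change (θ d)⁻¹ • (quotientMapOfHom N θ y' * (g i : G ⧸ N)) =
      quotientMapOfHom N θ (d⁻¹ • y') * (g i : G ⧸ N)
    rw [quotientMapOfHom_smul, map_inv, smul_mul_quotient]
  let Zfun : D → TopRep.res (θ : D →* G) (coindFin X N) := fun d y => (F (e.symm y).1).1 d (e.symm y).2
  have hZcont : Continuous Zfun :=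
    continuous_pi fun y => (continuous_apply (e.symm y).2).comp (F (e.symm y).1).1.continuous
  have hZ : ∀ (d d' : D) (i : ι) (y' : D ⧸ N.comap (θ : D →* G)),
      Zfun d' ((θ d)⁻¹ • e (i, y')) = (F i).1 d' (d⁻¹ • y') := fun d d' i y' => by
    change (F (e.symm ((θ d)⁻¹ • e (i, y'))).1).1 d' (e.symm ((θ d)⁻¹ • e (i, y'))).2 = _
    rw [key]
  have hZe : ∀ (d : D) (i : ι) (y' : D ⧸ N.comap (θ : D →* G)), Zfun d (e (i, y')) = (F i).1 d y' := fun d i y' => by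
    change (F (e.symm (e (i, y'))).1).1 d (e.symm (e (i, y'))).2 = _
    rw [Equiv.symm_apply_apply]
  let Z : contOneCocycles (TopRep.res (θ : D →* G) (coindFin X N)) :=
    ⟨⟨Zfun, hZcont⟩, fun d d' => by
      funext y
      obtain ⟨⟨i, y'⟩, rfl⟩ := e.surjective y
      have hFi := congrFun ((F i).2 d d') y'
      change Zfun (d * d') (e (i, y')) = Zfun d (e (i, y')) + (coindFin X N).ρ (θ d) (Zfun d') (e (i, y'))
      rw [coindFin_ρ_apply, hZ, hZe, hZe, hFi]
      rfl⟩
  refine ⟨oneCocycleClass _ Z, fun i => ?_⟩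
  rw [← hF i, cohomologyMap_oneCocycleClass]
  congr 1
  refine Subtype.ext (ContinuousMap.ext fun d => funext fun y' => ?_)
  rw [pullback_id_resIdHom_apply, resCoindFinHomR_apply]
  exact hZe d i y'

omit [IsTopologicalGroup G] in
/-- **(B5′) R1 in the typed form `LocalMackeyH1Surjective` follows** (targets `Sh^D(b_i)`). -/
theorem localMackeyH1Surjective (X : TopRep.{v} R G) (N : Subgroup G) [N.Normal] (θ : D →ₜ* G)
    (hN : IsOpen (N : Set G)) : LocalMackeyH1Surjective.{u, v, w} X N θ hN := by
  intro ι _ g hbij sD hsD hsD1 b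
  exact exists_cohomologyMap_resCoindFinHomR_eq X N θ g hbij fun i =>
    shapiroLift (TopRep.res (θ : D →* G) X) (N.comap (θ : D →* G)) (isOpen_comap N θ hN) hsD hsD1 (b i)

end

end Summit.BirchSwinnertonDyer.BirchSwinnertonDyer.Cruxes.ResidualThetaCountLowerPureAtTwo.SideaK3G11
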